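/-
Copyright (c) 2026 the pub-hodgecm-mathlib formalisation cell (harness21).  Prover seat hodgecm-mathlib-LH4-p14 (g3): Track A «(D-RAM) FOUR-FRAME» squad of crux H413, (ρ2b′-X) payer of record;
organ T2b «GLUE FIBRE COUNT» of the payer ORDER v1 (`F0/P3c/LH4/LH4-p14/g3/RHO2BX-ORDER.v1.LH4p14g3.md`), 2026-09-04.
-/
import Literature.NumberTheory.Automorphic.UnitaryLatticeTreeBlockGlueFibre     -- ★ p857187 (this seat) T2a: `glueData_of_generator`, `eq_iff_of_generators`, `glued_of_glueData`; brings ★ TubeAxisVertex∕TubeCoordinate∕BlockGluing∕Framed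
import Literature.NumberTheory.Automorphic.UnitaryThreePHTowerRho               -- ★ `mem_maximalIdeal_pow_iff_v_le` (`y ∈ 𝓂^m ↔ |y| ≤ |ϖ^m|`)
import HarnessLib

/-!
# The lattice graph of a hermitian space — THE GLUE FIBRE COUNT: self-dual lattices with a given W-part `B` and tube coordinate `b ≥ 1` ↔ the norm-residue set `Sol_{2b}(r_B)`
# (Jacobowitz 1962 §4; Bruhat–Tits 1972 §10; Kottwitz 1986 §1)

Topic `NumberTheory/Automorphic`; namespace `Literature.NumberTheory.Automorphic.UnitaryLatticeTree`.  THEOREMS ONLY (no definition, no instance, no notation, no named fact,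
no `sorry`); kernel lane `--supports stmt-HodgeConjecture-24833`; DATUM-FREE (`K` with `Valued K ℤᵐ⁰` and `𝒪[K]` a PID, `σ` a valuation-preserving involution, `|ϖ| = exp(−1)`;
no `|2| = 1`, no `σϖ = ±ϖ`).  Cell `pub/hodgecm-mathlib`, crux H413 = `stmt-HodgeConjecture-24833`; squad F0∕P3c∕LH4 «(D-RAM) FOUR-FRAME», the WILD type-(2) G-side census
(ρ2b′-X) of `Cruxes/H413/Lines/F0_P3c_DyRamFourFrame_U2H_HSide.lean` :418 (payer plan LH4-p12 (g3) v2 8ff3a79c D5∕D6 «#glue = A(a, ξ)»; payer ORDER v1 b16823cc organ T2).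
HONEST LABEL: HC_CM is proved only modulo the 7 printed citations (2 remaining named inputs: hLiu418 = stmt-HodgeConjecture-24832, h413 = stmt-HodgeConjecture-24833) until rung 0
closes; elementary lattice algebra over a valuation ring, no books consequence.

THE MATHEMATICS (block currency of ★ `UnitaryLatticeTreeTubeCoordinate`, `H = !![H₂ 0 0, 0, H₂ 0 1; 0, h, 0; H₂ 1 0, 0, H₂ 1 1]`, `W = {x | x₁ = 0}`).  Sequel of ★ p857187
(T2a: converse gluing, injectivity, existence).  **`ncard_glueFibre_eq_natCard_normFibre`**: for a `W`-submodule `B` containing a frame (`latt a₀ ≤ B ⊔ 𝒪ϖ^b e₁`), `b ≥ 1`, and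
a dual direction `w₀ ∈ W` with (G1) «`B` is the `W`-dual of `B + 𝒪w₀`» and `|⟨w₀, w₀⟩| = |ϖ|^{−2b}`, the set of SELF-DUAL lattices `M` with `M ∩ W = B` and tube coordinate `b`
is in bijection with `Sol_{2b}(r_B) := {u ∈ 𝒪 mod 𝓂^{2b} : |u·σu − r_B| ≤ |ϖ^{2b}|}`, `r_B := −⟨w₀,w₀⟩·ϖ^bσ(ϖ^b)∕h` — the subtype of ★ p856820 `WildQuadraticDatumNormFibres`
VERBATIM — via `u ↦ B ⊔ 𝒪(w₀ + ϖ^{−b}u·e₁)`: well-defined and into the fibre by T2a §3 + the PID sandwich `latt a₀ ≤ M = M^♯ ≤ (latt a₀)^♯` (★ `exists_eq_latt_of_latt_le_of_le_latt`,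
★ `isSelfDualLattice_latt_of_dualLatt_eq`); injective by T2a §2 (the glue parameter is the unit class mod `ϖ^{2b}`, ★ `mem_maximalIdeal_pow_iff_v_le`); surjective by T2a §1 and
the DUAL TRICK — for `M` in the fibre, `w₀ + t·e₁ ∈ M^♯ = M` with `t := −⟨x₁, w₀⟩∕(σ(x₁,₁)h)` for any generator `x₁`, and `|t| = |ϖ|^{−b}` is forced by `|⟨w₀,w₀⟩| = |ϖ|^{−2b}`.
Hence `#Fibre(B, b) = #Sol_{2b}(r_B)` = `q^b` (`1 ≤ b < d`), `2q^b` ∕ `0` (`b ≥ d`, by the norm class of `r_B`) by ★ p856847∕p856861 — payer plan D6's glue count `A(b, ξ)`.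

## References
* [Jacobowitz1962] R. Jacobowitz, *Hermitian forms over local fields*, Amer. J. Math. 84 (1962), §4 (dual lattices, gluing of modular components).
* [BruhatTits1972] F. Bruhat, J. Tits, *Groupes réductifs sur un corps local I*, Publ. Math. IHÉS 41 (1972), §10 (lattice models of the rank-one building).
* [Kottwitz1986BaseChangeUnits] R. E. Kottwitz, *Base change for unit elements of Hecke algebras*, Compositio Math. 60 (1986), §1 pp. 240–241 (orbital integrals of units as lattice counts).
-/

set_option autoImplicit false

noncomputable section

open scoped Valued WithZero Matrix MatrixGroups

namespace Literature.NumberTheory.Automorphic.UnitaryLatticeTree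

open Literature.NumberTheory.Automorphic Literature.NumberTheory.Automorphic.HermitianLattice

variable {K : Type*} [Field K] [Valued K ℤᵐ⁰]

/-! ## §1 The count: the glue fibre over `(B, b)` is in bijection with the norm-residue set `Sol_{2b}(r_B)` -/

section Count

open Literature.NumberTheory.Automorphic.UnitaryGroup (mem_maximalIdeal_pow_iff_v_le)

/-- **THE GLUE FIBRE COUNT.**  Block form, `σ` an isometric involution, `H` hermitian; `B ≤ W` a `W`-lattice containing a frame (`latt a₀ ≤ B ⊔ 𝒪ϖ^b e₁`, PID), `b ≥ 1`,
and a dual direction `w₀ ∈ W` with (G1) «`B` is the `W`-dual of `B + 𝒪w₀`» and `|⟨w₀, w₀⟩| = |ϖ|^{−2b}`.  Then the self-dual lattices `M` with `W`-part `M ∩ W = B` and tube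
coordinate `b` are in BIJECTION with the norm-residue classes `Sol_{2b}(r_B) = {u ∈ 𝒪 mod 𝓂^{2b} : |u·σu − r_B| ≤ |ϖ^{2b}|}`, `r_B := −⟨w₀,w₀⟩·ϖ^bσ(ϖ^b)∕h`, via
`u ↦ B ⊔ 𝒪(w₀ + ϖ^{−b}u·e₁)` (§3 existence, §2 injectivity, §1 + the dual trick `w₀ + t e₁ ∈ M^♯ = M` for surjectivity); in particular the two sets have the same cardinality —
the census reads `#glue(B, b) = #Sol_{2b}(r_B)` = `q^b ∕ 2q^b ∕ 0` by ★ `WildQuadraticDatumNormFibres` (p856820∕p856847∕p856861).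
[cite: Jacobowitz1962, §4] [cite: BruhatTits1972, §10] [cite: Kottwitz1986BaseChangeUnits, §1 pp. 240–241] -/
theorem ncard_glueFibre_eq_natCard_normFibre [IsPrincipalIdealRing 𝒪[K]] (σ : K →+* K) (hσ : ∀ a, σ (σ a) = a) (hvσ : ∀ a, Valued.v (σ a) = Valued.v a)
    {ϖ : K} (hϖ : Valued.v ϖ = WithZero.exp (-1 : ℤ))
    {H₂ : Matrix (Fin 2) (Fin 2) K} (hH₂ : IsUnit H₂.det) (hH₂σ : (H₂.map σ)ᵀ = H₂) {h : K} (hh : Valued.v h = 1) (hhσ : σ h = h)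
    {B : Submodule 𝒪[K] (Fin 3 → K)} (hBW : ∀ y ∈ B, y 1 = 0) {b : ℕ} (hb1 : 1 ≤ b)
    (a₀ : GL (Fin 3) K) (ha₀ : latt (a₀ : Matrix (Fin 3) (Fin 3) K) ≤ B ⊔ Submodule.span 𝒪[K] {(Pi.single 1 (ϖ ^ b) : Fin 3 → K)})
    {w₀ : Fin 3 → K} (hw₀1 : w₀ 1 = 0)
    (hG1 : ∀ w : Fin 3 → K, w 1 = 0 →
      (w ∈ B ↔ (∀ y ∈ B, Valued.v (pairing σ (!![H₂ 0 0, 0, H₂ 0 1; 0, h, 0; H₂ 1 0, 0, H₂ 1 1] : Matrix (Fin 3) (Fin 3) K) y w) ≤ 1) ∧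
        Valued.v (pairing σ (!![H₂ 0 0, 0, H₂ 0 1; 0, h, 0; H₂ 1 0, 0, H₂ 1 1] : Matrix (Fin 3) (Fin 3) K) w₀ w) ≤ 1))
    (hw₀ : Valued.v (pairing σ (!![H₂ 0 0, 0, H₂ 0 1; 0, h, 0; H₂ 1 0, 0, H₂ 1 1] : Matrix (Fin 3) (Fin 3) K) w₀ w₀) * Valued.v ϖ ^ (2 * b) = 1) :
    {M : Submodule 𝒪[K] (Fin 3 → K) | IsSelfDualLattice σ ϖ (!![H₂ 0 0, 0, H₂ 0 1; 0, h, 0; H₂ 1 0, 0, H₂ 1 1] : Matrix (Fin 3) (Fin 3) K) M ∧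
        M ⊓ LinearMap.ker ((LinearMap.proj (1 : Fin 3) : (Fin 3 → K) →ₗ[K] K).restrictScalars 𝒪[K]) = B ∧
        ∀ c : K, (Pi.single 1 c : Fin 3 → K) ∈ M ↔ Valued.v c ≤ Valued.v ϖ ^ b}.ncard =
      Nat.card {x : 𝒪[K] ⧸ 𝓂[K] ^ (2 * b) // ∃ u : 𝒪[K], Ideal.Quotient.mk (𝓂[K] ^ (2 * b)) u = x ∧
        Valued.v ((u : K) * σ u - (-(pairing σ (!![H₂ 0 0, 0, H₂ 0 1; 0, h, 0; H₂ 1 0, 0, H₂ 1 1] : Matrix (Fin 3) (Fin 3) K) w₀ w₀) * (ϖ ^ b * σ (ϖ ^ b)) / h)) ≤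
          Valued.v (ϖ ^ (2 * b))} := by
  classical
  set H : Matrix (Fin 3) (Fin 3) K := !![H₂ 0 0, 0, H₂ 0 1; 0, h, 0; H₂ 1 0, 0, H₂ 1 1] with hHdef
  set Wk : Submodule 𝒪[K] (Fin 3 → K) := LinearMap.ker ((LinearMap.proj (1 : Fin 3) : (Fin 3 → K) →ₗ[K] K).restrictScalars 𝒪[K]) with hWk
  set r : K := -(pairing σ H w₀ w₀) * (ϖ ^ b * σ (ϖ ^ b)) / h with hr
  -- bookkeeping
  have hHrow : ∀ l : Fin 3, l ≠ 1 → H 1 l = 0 := fun l hl => endoShapeForm_row H₂ h l hl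
  have hHcol : ∀ l : Fin 3, l ≠ 1 → H l 1 = 0 := fun l hl => endoShapeForm_col H₂ h l hl
  have hH11e : H 1 1 = h := endoShapeForm_one_one H₂ h
  have hHdet : IsUnit H.det := isUnit_det_endoShapeForm hH₂ hh
  have hsymm : ∀ x y : Fin 3 → K, Valued.v (pairing σ H y x) = Valued.v (pairing σ H x y) :=
    v_pairing_comm_of_hermitian hvσ hσ (endoShapeForm_hermitian hH₂σ hhσ)
  have hmemWk : ∀ w : Fin 3 → K, w ∈ Wk ↔ w 1 = 0 := fun w => by rw [hWk, LinearMap.mem_ker]; rfl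
  have hvϖ0 : Valued.v ϖ ≠ 0 := by rw [hϖ]; exact WithZero.exp_ne_zero
  have hϖ0 : ϖ ≠ 0 := fun h0 => by rw [h0, map_zero] at hvϖ0; exact hvϖ0 rfl
  have hϖ1 : Valued.v ϖ ≤ 1 := by rw [hϖ, ← WithZero.exp_zero, WithZero.exp_le_exp]; omega
  have hϖb0 : Valued.v ϖ ^ b ≠ 0 := pow_ne_zero _ hvϖ0
  have hϖbne : ϖ ^ b ≠ 0 := pow_ne_zero _ hϖ0
  have hh0 : h ≠ 0 := fun h0 => by rw [h0, map_zero] at hh; exact zero_ne_one hh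
  have hpos : 0 < Valued.v ϖ ^ b := zero_lt_iff.2 hϖb0
  have hvpow : Valued.v (ϖ ^ (2 * b)) = Valued.v ϖ ^ b * Valued.v ϖ ^ b := by rw [map_pow, two_mul, pow_add]
  -- the scalar `k = ϖ^b σ(ϖ^b) ∕ h`, `|k| = |ϖ|^{2b}`
  have hk : Valued.v (ϖ ^ b * σ (ϖ ^ b) / h) = Valued.v ϖ ^ b * Valued.v ϖ ^ b := by
    rw [map_div₀, map_mul, hvσ, hh, div_one, map_pow]
  have hσϖ : σ (ϖ ^ b) ≠ 0 := fun h0 => hϖbne (by rw [← hσ (ϖ ^ b), h0, map_zero])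
  have hk0 : ϖ ^ b * σ (ϖ ^ b) / h ≠ 0 := div_ne_zero (mul_ne_zero hϖbne hσϖ) hh0
  -- the generator attached to a lift `c`
  obtain ⟨gen, hgen⟩ : ∃ gen : K → (Fin 3 → K), ∀ c, gen c = w₀ + Pi.single 1 ((ϖ ^ b)⁻¹ * c) := ⟨_, fun _ => rfl⟩
  have hgen1 : ∀ c, gen c 1 = (ϖ ^ b)⁻¹ * c := fun c => by
    rw [hgen, Pi.add_apply, hw₀1, Pi.single_eq_same, zero_add]
  have hgenW : ∀ c, gen c - Pi.single 1 (gen c 1) = w₀ := fun c => by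
    rw [hgen1, hgen, add_sub_cancel_right]
  have hpairW : ∀ (c : K) (w : Fin 3 → K), w 1 = 0 → pairing σ H (gen c) w = pairing σ H w₀ w := fun c w hw => by
    rw [hgen, map_add, LinearMap.add_apply, pairing_single_left_of_block σ H 1 hHrow, hw, mul_zero, add_zero]
  have hpair_self : ∀ c : K, pairing σ H (gen c) (gen c) = pairing σ H w₀ w₀ + σ ((ϖ ^ b)⁻¹ * c) * h * ((ϖ ^ b)⁻¹ * c) := fun c => by
    rw [hgen, LinearMap.map_add₂, (pairing σ H w₀).map_add, (pairing σ H (Pi.single 1 ((ϖ ^ b)⁻¹ * c))).map_add,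
      pairing_single_right_of_block σ H 1 hHcol w₀, hw₀1, map_zero, zero_mul, zero_mul, add_zero,
      pairing_single_left_of_block σ H 1 hHrow, hw₀1, mul_zero, zero_add, pairing_single_left_of_block σ H 1 hHrow, Pi.single_eq_same, hH11e]
  -- the norm identity `c·σc − r = ⟨gen c, gen c⟩ · k`
  have hnorm : ∀ c : K, c * σ c - r = pairing σ H (gen c) (gen c) * (ϖ ^ b * σ (ϖ ^ b) / h) := fun c => by
    rw [hpair_self, hr, map_mul, map_inv₀]
    field_simp
    ring
  have hG2_iff : ∀ c : K, Valued.v (pairing σ H (gen c) (gen c)) ≤ 1 ↔ Valued.v (c * σ c - r) ≤ Valued.v (ϖ ^ (2 * b)) := fun c => by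
    rw [hnorm, map_mul, hk, hvpow]
    constructor
    · intro h1; exact mul_le_of_le_one_left zero_le h1
    · intro h1
      by_contra hgt
      rw [not_le] at hgt
      have := mul_lt_mul_of_pos_right hgt (mul_pos hpos hpos)
      rw [one_mul] at this
      exact absurd h1 (not_le.2 this)
  -- `|r| = 1`, and the norm condition forces `|c| = 1`
  have hw₀v : Valued.v (pairing σ H w₀ w₀) = (Valued.v ϖ ^ b * Valued.v ϖ ^ b)⁻¹ := by
    rw [two_mul, pow_add] at hw₀; exact eq_inv_of_mul_eq_one_left hw₀
  have hr1 : Valued.v r = 1 := by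
    rw [hr, map_div₀, map_mul, Valuation.map_neg, hw₀v, map_mul, hvσ, map_pow, hh, div_one, inv_mul_cancel₀ (mul_ne_zero hϖb0 hϖb0)]
  have hunit : ∀ c : K, Valued.v c ≤ 1 → Valued.v (c * σ c - r) ≤ Valued.v (ϖ ^ (2 * b)) → Valued.v c = 1 := fun c hc hN => by
    have hlt : Valued.v (c * σ c - r) < 1 := by
      refine lt_of_le_of_lt hN ?_
      rw [hvpow]
      have h1 : Valued.v ϖ ^ b < 1 := pow_lt_one₀ zero_le (by rw [hϖ, ← WithZero.exp_zero, WithZero.exp_lt_exp]; omega) (by omega)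
      exact mul_lt_one_of_nonneg_of_lt_one_left zero_le h1 h1.le
    have hN1 : Valued.v (c * σ c) = 1 := by
      have e : c * σ c = (c * σ c - r) + r := (sub_add_cancel _ _).symm
      rw [e, Valuation.map_add_eq_of_lt_right _ (by rw [hr1]; exact hlt), hr1]
    rw [map_mul, hvσ] at hN1
    rcases lt_or_eq_of_le hc with hlt' | heq
    · exact absurd hN1 (ne_of_lt (mul_lt_one_of_nonneg_of_lt_one_left zero_le hlt' hc))
    · exact heq
  have hgen_size : ∀ c : K, Valued.v c = 1 → Valued.v (gen c 1) * Valued.v ϖ ^ b = 1 := fun c hc => by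
    rw [hgen1, map_mul, map_inv₀, map_pow, hc, mul_one, inv_mul_cancel₀ hϖb0]
  -- (G1) transfers from `w₀` to every `gen c`
  have hG1' : ∀ (c : K) (w : Fin 3 → K), w 1 = 0 → (w ∈ B ↔ (∀ y ∈ B, Valued.v (pairing σ H y w) ≤ 1) ∧ Valued.v (pairing σ H (gen c) w) ≤ 1) :=
    fun c w hw => by rw [hpairW c w hw]; exact hG1 w hw
  -- the frame sandwich for the glued lattices: `latt a₀ ≤ M ≤ latt c₀`
  have hdetc : ((a₀ : Matrix (Fin 3) (Fin 3) K) * (formCongr σ a₀ H)⁻¹).det ≠ 0 := by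
    have hga : IsUnit (a₀ : Matrix (Fin 3) (Fin 3) K).det := Matrix.isUnits_det_units a₀
    have hGdet : IsUnit (formCongr σ a₀ H).det := by
      rw [formCongr, Matrix.det_mul, Matrix.det_mul]
      exact ((isUnit_det_transpose_map σ hga).mul hHdet).mul hga
    rw [Matrix.det_mul, Matrix.det_nonsing_inv]
    exact mul_ne_zero hga.ne_zero (isUnit_ringInverse.2 hGdet).ne_zero
  set c₀ : GL (Fin 3) K := Matrix.GeneralLinearGroup.mkOfDetNeZero _ hdetc with hc₀
  have hMframe : ∀ M : Submodule 𝒪[K] (Fin 3 → K), dualLatt σ H M = M → B ≤ M → (Pi.single 1 (ϖ ^ b) : Fin 3 → K) ∈ M →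
      IsSelfDualLattice σ ϖ H M := fun M hMd hBM hϖM => by
    have hlo : latt (a₀ : Matrix (Fin 3) (Fin 3) K) ≤ M := ha₀.trans (sup_le hBM ((Submodule.span_singleton_le_iff_mem _ _).2 hϖM))
    have hhi : M ≤ latt (c₀ : Matrix (Fin 3) (Fin 3) K) := by
      rw [hc₀, Matrix.GeneralLinearGroup.val_mkOfDetNeZero, ← dualLatt_latt σ hvσ hHdet a₀, ← hMd]
      exact dualLatt_antitone σ H hlo
    obtain ⟨g, rfl⟩ := exists_eq_latt_of_latt_le_of_le_latt a₀ c₀ M hlo hhi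
    exact isSelfDualLattice_latt_of_dualLatt_eq σ hvσ hϖ0 hϖ1 hHdet g hMd
  -- the two sets
  set S := {x : 𝒪[K] ⧸ 𝓂[K] ^ (2 * b) // ∃ u : 𝒪[K], Ideal.Quotient.mk (𝓂[K] ^ (2 * b)) u = x ∧ Valued.v ((u : K) * σ u - r) ≤ Valued.v (ϖ ^ (2 * b))} with hS
  set F := {M : Submodule 𝒪[K] (Fin 3 → K) | IsSelfDualLattice σ ϖ H M ∧ M ⊓ Wk = B ∧ ∀ c : K, (Pi.single 1 c : Fin 3 → K) ∈ M ↔ Valued.v c ≤ Valued.v ϖ ^ b} with hF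
  -- membership of a glued lattice in `F`, for a lift `u` satisfying the norm condition
  have hmemF : ∀ u : 𝒪[K], Valued.v ((u : K) * σ u - r) ≤ Valued.v (ϖ ^ (2 * b)) → B ⊔ Submodule.span 𝒪[K] {gen u} ∈ F := fun u hu => by
    have hc1 : Valued.v (u : K) = 1 := hunit u u.2 hu
    have hG2 : Valued.v (pairing σ H (gen u) (gen u)) ≤ 1 := (hG2_iff u).2 hu
    obtain ⟨hMd, htube, hWpart, hx₀⟩ := glued_of_glueData σ hσ hvσ hϖ hH₂σ hh hhσ hBW hb1 (hgen_size u hc1) (hG1' u) hG2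
    refine ⟨hMframe _ hMd le_sup_left ((htube _).2 (by rw [map_pow])), hWpart, htube⟩
  -- the map `Φ : S → F`
  obtain ⟨Φ, hΦval⟩ : ∃ Φ : S → F, ∀ x : S, ((Φ x : F) : Submodule 𝒪[K] (Fin 3 → K)) = B ⊔ Submodule.span 𝒪[K] {gen (x.2.choose : K)} :=
    ⟨fun x => ⟨B ⊔ Submodule.span 𝒪[K] {gen (x.2.choose : K)}, hmemF x.2.choose x.2.choose_spec.2⟩, fun _ => rfl⟩
  -- two glued members of `F` coincide iff the lifts are congruent mod `𝓂^{2b}`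
  have hpr_of_mem : ∀ M ∈ F, ∀ x ∈ M, Valued.v (x 1) * Valued.v ϖ ^ b ≤ 1 := by
    rintro M ⟨hM, -, hbM⟩ x hx
    obtain ⟨b', hb', hpr', -⟩ := exists_tubeCoordinate σ hvσ hϖ hH₂ hh hM
    rw [(tubeCoordinate_unique hϖ hb' hbM).1] at hpr'
    exact hpr' x hx
  have heq_iff : ∀ u u' : 𝒪[K], B ⊔ Submodule.span 𝒪[K] {gen u} ∈ F → B ⊔ Submodule.span 𝒪[K] {gen u'} ∈ F →
      (B ⊔ Submodule.span 𝒪[K] {gen u} = B ⊔ Submodule.span 𝒪[K] {gen u'} ↔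
        Ideal.Quotient.mk (𝓂[K] ^ (2 * b)) u = Ideal.Quotient.mk (𝓂[K] ^ (2 * b)) u') := fun u u' hM hM' => by
    have hcu : Valued.v (u : K) = 1 := by
      by_contra hne
      have hlt : Valued.v (u : K) < 1 := lt_of_le_of_ne u.2 hne
      -- a non-unit lift glues a lattice whose tube coordinate is not `b`: its generator entry is too small
      have hx₀ : gen u ∈ B ⊔ Submodule.span 𝒪[K] {gen u} := Submodule.mem_sup_right (Submodule.mem_span_singleton_self _)
      have hsize : Valued.v (gen u 1) * Valued.v ϖ ^ b < 1 := by
        rw [hgen1, map_mul, map_inv₀, map_pow, mul_comm (Valued.v ϖ ^ b)⁻¹, mul_assoc, inv_mul_cancel₀ hϖb0, mul_one]; exact hlt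
      -- but `gen u − (small)·?`: use (G2) failure instead: |⟨gen u, gen u⟩| = |⟨w₀,w₀⟩| > 1 contradicts `M ≤ M^♯`
      have hMd : B ⊔ Submodule.span 𝒪[K] {gen u} ≤ dualLatt σ H (B ⊔ Submodule.span 𝒪[K] {gen u}) := le_dualLatt_of_isVertexLattice hvσ hM.1
      have hle : Valued.v (pairing σ H (gen u) (gen u)) ≤ 1 := (mem_dualLatt σ H _ _).1 (hMd hx₀) _ hx₀
      have hbig : Valued.v (σ ((ϖ ^ b)⁻¹ * u) * h * ((ϖ ^ b)⁻¹ * u)) < Valued.v (pairing σ H w₀ w₀) := by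
        rw [hw₀v, map_mul, map_mul, hvσ, hh, mul_one, map_mul, map_inv₀, map_pow]
        have hu1 : Valued.v (u : K) ≤ 1 := u.2
        calc (Valued.v ϖ ^ b)⁻¹ * Valued.v (u : K) * ((Valued.v ϖ ^ b)⁻¹ * Valued.v (u : K))
            = (Valued.v ϖ ^ b * Valued.v ϖ ^ b)⁻¹ * (Valued.v (u : K) * Valued.v (u : K)) := by rw [mul_inv, mul_mul_mul_comm]
          _ < (Valued.v ϖ ^ b * Valued.v ϖ ^ b)⁻¹ * 1 := by
              refine mul_lt_mul_of_pos_left ?_ (inv_pos.2 (mul_pos hpos hpos))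
              exact mul_lt_one_of_nonneg_of_lt_one_left zero_le hlt hu1
          _ = (Valued.v ϖ ^ b * Valued.v ϖ ^ b)⁻¹ := mul_one _
      have hgt : 1 < Valued.v (pairing σ H (gen u) (gen u)) := by
        rw [hpair_self, Valuation.map_add_eq_of_lt_left _ hbig, hw₀v, one_lt_inv₀ (mul_pos hpos hpos)]
        have h1 : Valued.v ϖ ^ b < 1 := pow_lt_one₀ zero_le (by rw [hϖ, ← WithZero.exp_zero, WithZero.exp_lt_exp]; omega) (by omega)
        exact mul_lt_one_of_nonneg_of_lt_one_left zero_le h1 h1.le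
      exact absurd hle (not_le.2 hgt)
    have hcu' : Valued.v (u' : K) = 1 := by
      by_contra hne
      have hlt : Valued.v (u' : K) < 1 := lt_of_le_of_ne u'.2 hne
      have hx₀ : gen u' ∈ B ⊔ Submodule.span 𝒪[K] {gen u'} := Submodule.mem_sup_right (Submodule.mem_span_singleton_self _)
      have hMd : B ⊔ Submodule.span 𝒪[K] {gen u'} ≤ dualLatt σ H (B ⊔ Submodule.span 𝒪[K] {gen u'}) := le_dualLatt_of_isVertexLattice hvσ hM'.1
      have hle : Valued.v (pairing σ H (gen u') (gen u')) ≤ 1 := (mem_dualLatt σ H _ _).1 (hMd hx₀) _ hx₀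
      have hbig : Valued.v (σ ((ϖ ^ b)⁻¹ * u') * h * ((ϖ ^ b)⁻¹ * u')) < Valued.v (pairing σ H w₀ w₀) := by
        rw [hw₀v, map_mul, map_mul, hvσ, hh, mul_one, map_mul, map_inv₀, map_pow]
        have hu1 : Valued.v (u' : K) ≤ 1 := u'.2
        calc (Valued.v ϖ ^ b)⁻¹ * Valued.v (u' : K) * ((Valued.v ϖ ^ b)⁻¹ * Valued.v (u' : K))
            = (Valued.v ϖ ^ b * Valued.v ϖ ^ b)⁻¹ * (Valued.v (u' : K) * Valued.v (u' : K)) := by rw [mul_inv, mul_mul_mul_comm]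
          _ < (Valued.v ϖ ^ b * Valued.v ϖ ^ b)⁻¹ * 1 := by
              refine mul_lt_mul_of_pos_left ?_ (inv_pos.2 (mul_pos hpos hpos))
              exact mul_lt_one_of_nonneg_of_lt_one_left zero_le hlt hu1
          _ = (Valued.v ϖ ^ b * Valued.v ϖ ^ b)⁻¹ := mul_one _
      have hgt : 1 < Valued.v (pairing σ H (gen u') (gen u')) := by
        rw [hpair_self, Valuation.map_add_eq_of_lt_left _ hbig, hw₀v, one_lt_inv₀ (mul_pos hpos hpos)]
        have h1 : Valued.v ϖ ^ b < 1 := pow_lt_one₀ zero_le (by rw [hϖ, ← WithZero.exp_zero, WithZero.exp_lt_exp]; omega) (by omega)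
        exact mul_lt_one_of_nonneg_of_lt_one_left zero_le h1 h1.le
      exact absurd hle (not_le.2 hgt)
    have key := eq_iff_of_generators σ hσ hvσ hϖ hH₂ hH₂σ hh hhσ hM.1 hM'.1 hb1 hM.2.2 (hpr_of_mem _ hM) hM'.2.2 (hpr_of_mem _ hM')
      (by rw [hM.2.1, hM'.2.1]) (Submodule.mem_sup_right (Submodule.mem_span_singleton_self _)) (hgen_size u hcu)
      (Submodule.mem_sup_right (Submodule.mem_span_singleton_self _)) (hgen_size u' hcu') (by rw [hgenW, hgenW])
    rw [key, hgen1, hgen1, ← mul_sub, map_mul, map_inv₀, map_pow, Ideal.Quotient.eq, mem_maximalIdeal_pow_iff_v_le hϖ]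
    -- `|ϖ^{-b}(u' − u)| ≤ |ϖ|^b ⟺ |u − u'| ≤ |ϖ^{2b}|`
    rw [inv_mul_le_iff₀ hpos, hvpow]
    show Valued.v ((u' : K) - u) ≤ _ ↔ Valued.v (((u - u' : 𝒪[K]) : 𝒪[K]) : K) ≤ _
    rw [show (((u - u' : 𝒪[K]) : 𝒪[K]) : K) = (u : K) - u' from rfl, ← Valuation.map_neg _ ((u : K) - u'), neg_sub]
  -- Φ is injective
  have hinj : Function.Injective Φ := by
    intro x x' hxx'
    have hsets : ((Φ x : F) : Submodule 𝒪[K] (Fin 3 → K)) = ((Φ x' : F) : Submodule 𝒪[K] (Fin 3 → K)) := by rw [hxx']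
    rw [hΦval, hΦval] at hsets
    have hmk := (heq_iff _ _ (hmemF _ x.2.choose_spec.2) (hmemF _ x'.2.choose_spec.2)).1 hsets
    apply Subtype.ext
    rw [← x.2.choose_spec.1, ← x'.2.choose_spec.1, hmk]
  -- Φ is surjective: the dual trick gives a generator with W-component `w₀`
  have hsurj : Function.Surjective Φ := by
    rintro ⟨M, hM, hMW, hbM⟩
    have hpr : ∀ x ∈ M, Valued.v (x 1) * Valued.v ϖ ^ b ≤ 1 := hpr_of_mem M ⟨hM, hMW, hbM⟩
    obtain ⟨b', hb', -, x₁, hx₁, hx₁1⟩ := exists_tubeCoordinate σ hvσ hϖ hH₂ hh hM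
    rw [(tubeCoordinate_unique hϖ hb' hbM).1] at hx₁1
    obtain ⟨hG1₁, -, hMeq⟩ := glueData_of_generator σ hvσ hϖ hH₂ hh hM hb1 hbM hpr hx₁ hx₁1
    rw [hMW] at hG1₁ hMeq
    have hx₁10 : x₁ 1 ≠ 0 := fun h0 => by rw [h0, map_zero, zero_mul] at hx₁1; exact zero_ne_one hx₁1
    have hσx₁ : σ (x₁ 1) ≠ 0 := fun h0 => hx₁10 (by rw [← hσ (x₁ 1), h0, map_zero])
    -- the candidate generator `x = w₀ + t e₁`
    set t : K := -(pairing σ H x₁ w₀) / (σ (x₁ 1) * h) with ht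
    set x : Fin 3 → K := w₀ + Pi.single 1 t with hxdef
    have hx1 : x 1 = t := by rw [hxdef]; show w₀ 1 + (Pi.single (1 : Fin 3) t : Fin 3 → K) 1 = t; rw [hw₀1, Pi.single_eq_same, zero_add]
    have hx₁x : pairing σ H x₁ x = 0 := by
      have hne : σ (x₁ 1) * h ≠ 0 := mul_ne_zero hσx₁ hh0
      rw [hxdef, (pairing σ H x₁).map_add, pairing_single_right_of_block σ H 1 hHcol, hH11e, ht, ← mul_div_assoc, mul_div_cancel_left₀ _ hne,
        add_neg_cancel]
    have hxM : x ∈ M := by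
      rw [← dualLatt_eq_self_of_isSelfDualLattice hvσ hHdet hM, mem_dualLatt]
      intro m hm
      rw [hMeq] at hm
      obtain ⟨s, hs, hβ⟩ := mem_sup_span_singleton_iff.1 hm
      have e : m = (m - s • x₁) + s • x₁ := (sub_add_cancel _ _).symm
      rw [e, LinearMap.map_add₂, LinearMap.map_smulₛₗ₂, smul_eq_mul, hx₁x, mul_zero, add_zero]
      -- `⟨β, x⟩ = ⟨β, w₀⟩` for `β ∈ B ⊆ W`, and `|⟨β, w₀⟩| = |⟨w₀, β⟩| ≤ 1` by (G1)
      have hβ1 : (m - s • x₁) 1 = 0 := hBW _ hβ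
      rw [hxdef, (pairing σ H (m - s • x₁)).map_add, pairing_single_right_of_block σ H 1 hHcol, hβ1, map_zero, zero_mul, zero_mul, add_zero,
        hsymm]
      exact ((hG1 _ hβ1).1 hβ).2
    -- `|t| = |ϖ|^{-b}` (else `|⟨x,x⟩| = |⟨w₀,w₀⟩| > 1`)
    have htv : Valued.v t * Valued.v ϖ ^ b = 1 := by
      have hle1 : Valued.v t * Valued.v ϖ ^ b ≤ 1 := by rw [← hx1]; exact hpr x hxM
      by_contra hne
      have hlt : Valued.v t * Valued.v ϖ ^ b < 1 := lt_of_le_of_ne hle1 hne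
      have hMd : M ≤ dualLatt σ H M := le_dualLatt_of_isVertexLattice hvσ hM
      have hle : Valued.v (pairing σ H x x) ≤ 1 := (mem_dualLatt σ H _ _).1 (hMd hxM) _ hxM
      have hxx : pairing σ H x x = pairing σ H w₀ w₀ + σ t * h * t := by
        rw [hxdef, LinearMap.map_add₂, (pairing σ H w₀).map_add, (pairing σ H (Pi.single 1 t)).map_add,
          pairing_single_right_of_block σ H 1 hHcol w₀, hw₀1, map_zero, zero_mul, zero_mul, add_zero,
          pairing_single_left_of_block σ H 1 hHrow, hw₀1, mul_zero, zero_add, pairing_single_left_of_block σ H 1 hHrow, Pi.single_eq_same, hH11e]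
      have hbig : Valued.v (σ t * h * t) < Valued.v (pairing σ H w₀ w₀) := by
        rw [hw₀v, map_mul, map_mul, hvσ, hh, mul_one]
        have htb : Valued.v t < (Valued.v ϖ ^ b)⁻¹ := by
          have h1 := mul_lt_mul_of_pos_right hlt (inv_pos.2 hpos)
          rwa [mul_inv_cancel_right₀ hϖb0, one_mul] at h1
        calc Valued.v t * Valued.v t < (Valued.v ϖ ^ b)⁻¹ * (Valued.v ϖ ^ b)⁻¹ := by
              rcases eq_or_ne (Valued.v t) 0 with h0 | h0
              · rw [h0, mul_zero]; exact mul_pos (inv_pos.2 hpos) (inv_pos.2 hpos)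
              · exact mul_lt_mul'' htb htb zero_le zero_le
          _ = (Valued.v ϖ ^ b * Valued.v ϖ ^ b)⁻¹ := by rw [mul_inv]
      have hgt : 1 < Valued.v (pairing σ H x x) := by
        rw [hxx, Valuation.map_add_eq_of_lt_left _ hbig, hw₀v, one_lt_inv₀ (mul_pos hpos hpos)]
        have h1 : Valued.v ϖ ^ b < 1 := pow_lt_one₀ zero_le (by rw [hϖ, ← WithZero.exp_zero, WithZero.exp_lt_exp]; omega) (by omega)
        exact mul_lt_one_of_nonneg_of_lt_one_left zero_le h1 h1.le
      exact absurd hle (not_le.2 hgt)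
    -- the unit `u₀ = ϖ^b t` and its class
    have hu₀v : Valued.v (ϖ ^ b * t) = 1 := by rw [map_mul, map_pow, mul_comm]; exact htv
    set u₀ : 𝒪[K] := ⟨ϖ ^ b * t, hu₀v.le⟩ with hu₀
    have hgenu₀ : gen (u₀ : K) = x := by
      rw [hgen, hxdef, show ((u₀ : 𝒪[K]) : K) = ϖ ^ b * t from rfl, ← mul_assoc, inv_mul_cancel₀ hϖbne, one_mul]
    have hcond : Valued.v ((u₀ : K) * σ u₀ - r) ≤ Valued.v (ϖ ^ (2 * b)) := by
      rw [← hG2_iff, hgenu₀]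
      exact (mem_dualLatt σ H _ _).1 (le_dualLatt_of_isVertexLattice hvσ hM hxM) _ hxM
    refine ⟨⟨Ideal.Quotient.mk (𝓂[K] ^ (2 * b)) u₀, u₀, rfl, hcond⟩, ?_⟩
    apply Subtype.ext
    rw [hΦval]
    -- the chosen lift glues the same lattice as `u₀`, which glues `M`
    have hMu₀ : B ⊔ Submodule.span 𝒪[K] {gen (u₀ : K)} = M := by
      rw [hgenu₀]
      obtain ⟨-, -, hMeq'⟩ := glueData_of_generator σ hvσ hϖ hH₂ hh hM hb1 hbM hpr hxM (by rw [hx1]; exact htv)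
      rw [hMW] at hMeq'
      exact hMeq'.symm
    have hmemu₀ : B ⊔ Submodule.span 𝒪[K] {gen (u₀ : K)} ∈ F := by rw [hMu₀]; exact ⟨hM, hMW, hbM⟩
    set xS : S := ⟨Ideal.Quotient.mk (𝓂[K] ^ (2 * b)) u₀, u₀, rfl, hcond⟩ with hxS
    have hchoose := xS.2.choose_spec
    exact ((heq_iff _ _ (hmemF _ hchoose.2) hmemu₀).2 hchoose.1).trans hMu₀
  -- conclude
  rw [← Nat.card_coe_set_eq]
  exact (Nat.card_eq_of_bijective Φ ⟨hinj, hsurj⟩).symm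

end Count

end Literature.NumberTheory.Automorphic.UnitaryLatticeTree

end
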